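import Literature.NumberTheory.Rogawski1990.ArchOrbFamGScalarCornerBookkeeping   -- ★ p851280 (F0P3a-p09): (s2) `gprimeBlockAt_eq_circleDiagonal_centre_of_scalar`; brings `gprimeBlockAt`, `circleDiagonal`, `archLocal`
import Literature.NumberTheory.Automorphic.ArchCayleyTowerFubini                  -- ★ p851247 (LH7-p02): `isCompact_setOf_conj_cayleyTorus_one_mem`, `integrable_towerIntegrand`; brings the Cayley tokens, ★ `integral_pi_of_isEmpty`
import Literature.NumberTheory.Automorphic.ArchLocalTorusOrbitalContinuity        -- ★ `isCompact_setOf_exists_conj_circleDiagonal_mem`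
import Literature.NumberTheory.Automorphic.ArchTorusOrbitalFubiniSmooth           -- ★ `isCompact_setOf_coe_archLocal_mem`
import Literature.NumberTheory.Automorphic.ArchLocalRegularOrbitClosed            -- ★ `locallyCompactSpace_archLocal`, `secondCountableTopology_archLocal`
import HarnessLib

/-!
# (B3-JUNCTION, MIXED CORNER) THE ITERATED FACE DESCENT — from the one-place parametric descent (leg (M2)) to the `m`-fold face tower

Sub-problem `HC_CM` of `HodgeConjecture`, route `HCCMUnconditional`, crux H413 `stub_N9` (stmt-24833), LH3 leaf organ **O-L1d′** (`hCm`): F0P3a-p08 (g23)'s «MIXEDTOWER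
assembly», face stage.  THEOREMS ONLY, lane `--supports stmt-HodgeConjecture-24833`.

THE MATHEMATICS.  Fix faces `e : Fin m → W` (compact-chart places `e j ∉ S′`) with base angles `pw j`.  The ONE-PLACE PARAMETRIC DESCENT at a place `w` with base angles
`p` (leg (M2), LH3-p04 (g4)'s `exists_descent_box_localOrbitalIntegral_param` after centre absorption ★ p851073, with the zero-propagation clause (Z)) is the hypothesis
schema `hdesc`: for EVERY finite-dimensional parameter space `P` and every global `C^∞` family `Θ : P × M₃(ℂ) → ℂ` with one compact matrix support, there are `K ≠ 0`, an open
`U ∋ p` and a global `C^∞` family `f : (P × ℝ³) × M₂(ℂ) → ℂ` with one compact matrix support, vanishing at every parameter where `Θ` vanishes identically, such that for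
`cw ∈ U` regular (`i ↦ e^{i cw_i}` injective)
`∫_{G_w} Θ(π, ↑↑(g γ_w(cw) g⁻¹)) dν_w = K • ∫_{U(J)} f((π, cw), ↑↑(h · P diag(e^{iψ}, e^{−iψ}) P⁻¹ · h⁻¹)) dμ₀`, `ψ = (cw₀ − cw₂)∕2`, `γ_w = gprimeBlockAt L α w S′`.
THE TOWER (`exists_faceDescentTower`): the same statement for the `m` faces at once — `Θ : P × (Fin m → M₃(ℂ)) → ℂ`, the product group `Π_j G_{e j}` with `⊗_j ν_{e j}` on the left,
`U(J)^m` with `⊗ μ₀` on the right, `f : (P × (Fin m → ℝ³)) × (Fin m → M₂(ℂ)) → ℂ`, blockwise compact supports, clause (Z).  Proof by induction on `m`: peel the factor `j = 0`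
(Mathlib `measurePreserving_piFinSuccAbove`, Fubini), descend it with the other blocks as MATRIX PARAMETERS (`P × (Fin m → M₃(ℂ))` is finite-dimensional), swap (Fubini; the
mixed integrand is continuous with compact support: §1), recurse on the remaining faces with the descended block as a parameter, un-peel on `U(J)^{m+1}`.
§1: regular angles have `sin ψ ≠ 0`; the conjugating set `{g ∈ G_w | ↑↑(g γ_w(cw) g⁻¹) ∈ C}` is compact at regular `cw` (★ (s2) + ★ `isCompact_setOf_exists_conj_circleDiagonal_mem`);
the `m`-fold face integrand on `Π_j G_{e j}` is integrable.
Harish-Chandra's descent [Varadarajan1977, Part I §3], Rogawski [Rogawski1990, §4.12 Lemma 4.12.1, §8.2 pp. 119–124], Fubini [vanDoorn2021HaarMeasure, §4 Thm. 3, §7].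
-/

noncomputable section

open MeasureTheory MeasureTheory.Measure Set Filter Topology Function NumberField NumberField.InfinitePlace
open Literature.NumberTheory.Automorphic Literature.NumberTheory.Automorphic.UnitaryGroup Literature.MeasureTheory.Constructions
open scoped MatrixGroups ContDiff Matrix.Norms.Operator

namespace Literature.NumberTheory.Rogawski1990

section Prelim

variable (L : Type) [Field L] (α : Fin 3 → L) (S' : Finset {w : InfinitePlace L // IsComplex w})

/-- At a regular angle triple (`i ↦ e^{i cw_i}` injective) the face angle `ψ = (cw₀ − cw₂)∕2` has `sin ψ ≠ 0`. [cite: Rogawski1990, §8.2 p. 122] -/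
theorem sin_half_sub_ne_zero_of_injective_circleExp {cw : Fin 3 → ℝ} (hreg : Injective fun i : Fin 3 => Circle.exp (cw i)) :
    Real.sin ((cw 0 - cw 2) / 2) ≠ 0 := by
  intro h0
  obtain ⟨n, hn⟩ := Real.sin_eq_zero_iff.1 h0
  have h02 : cw 0 = cw 2 + n * (2 * Real.pi) := by linarith
  have hexp : Circle.exp (cw 0) = Circle.exp (cw 2) := by
    rw [h02, Circle.exp_add, Circle.exp_int_mul_two_pi, mul_one]
  exact absurd (hreg hexp) (by decide)

/-- **Compact conjugating set at a regular chart torus point of a compact-chart place**: for `w ∉ S′`, `cw` regular and `C ⊆ M₃(ℂ)` compact,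
`{g ∈ G_w | ↑↑(g · γ_w(cw) · g⁻¹) ∈ C}` is compact (`γ_w(cw) = gprimeBlockAt L α w S′ cw = diag(e^{i cw_{τ⁻¹ k}})`, ★ (s2); ★ `isCompact_setOf_exists_conj_circleDiagonal_mem`).
[cite: Rogawski1990, §8.2 p. 122] [cite: DeitmarEchterhoff2014, Lemma 9.3.3] -/
theorem isCompact_setOf_conj_gprimeBlockAt_mem (hα : ∀ i, α i ≠ 0) {w : {w : InfinitePlace L // IsComplex w}} (hw : w ∉ S')
    {cw : Fin 3 → ℝ} (hreg : Injective fun i : Fin 3 => Circle.exp (cw i)) {C : Set (Matrix (Fin 3) (Fin 3) ℂ)} (hC : IsCompact C) :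
    IsCompact {g : ↥(archLocal L 3 (Matrix.diagonal α) w) |
      (((g * gprimeBlockAt L α w S' cw * g⁻¹ : ↥(archLocal L 3 (Matrix.diagonal α) w)) : GL (Fin 3) ℂ) : Matrix (Fin 3) (Fin 3) ℂ) ∈ C} := by
  have hγ := gprimeBlockAt_eq_circleDiagonal_centre_of_scalar L α w S' hw (x := fun _ _ => (0 : ℝ)) (fun _ _ => rfl) (fun _ => cw)
  set z : Fin 3 → Circle := fun k => Circle.exp ((fun (_ : {w : InfinitePlace L // IsComplex w}) (_ : Fin 3) => (0 : ℝ)) w 0) *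
    Circle.exp ((fun _ : {w : InfinitePlace L // IsComplex w} => cw) w ((lineOf (formSign L α w)).symm k) -
      (fun (_ : {w : InfinitePlace L // IsComplex w}) (_ : Fin 3) => (0 : ℝ)) w ((lineOf (formSign L α w)).symm k)) with hz
  have hzinj : Injective z := by
    intro k k' hkk'
    have h' : Circle.exp (cw ((lineOf (formSign L α w)).symm k)) = Circle.exp (cw ((lineOf (formSign L α w)).symm k')) := by
      simpa [hz, Circle.exp_zero, sub_zero, one_mul] using hkk'
    exact (lineOf (formSign L α w)).symm.injective (hreg h')
  have hCg : IsCompact {k : ↥(archLocal L 3 (Matrix.diagonal α) w) | ((k : GL (Fin 3) ℂ) : Matrix (Fin 3) (Fin 3) ℂ) ∈ C} :=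
    isCompact_setOf_coe_archLocal_mem L 3 α w hα hC
  have hS := isCompact_setOf_exists_conj_circleDiagonal_mem L 3 α w hα (isCompact_singleton (x := z)) (by rintro _ rfl; exact hzinj) hCg
  refine hS.of_isClosed_subset ?_ fun g hg => ⟨z, rfl, ?_⟩
  · exact hC.isClosed.preimage ((Units.continuous_val.comp continuous_subtype_val).comp ((continuous_id.mul continuous_const).mul continuous_id.inv))
  · have hg' : (((g * gprimeBlockAt L α w S' cw * g⁻¹ : ↥(archLocal L 3 (Matrix.diagonal α) w)) : GL (Fin 3) ℂ) : Matrix (Fin 3) (Fin 3) ℂ) ∈ C := by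
      simpa only [mem_setOf_eq] using hg
    rw [hγ] at hg'
    simpa only [mem_setOf_eq] using hg'

variable [∀ w : {w : InfinitePlace L // IsComplex w}, MeasurableSpace ↥(archLocal L 3 (Matrix.diagonal α) w)]
  [∀ w : {w : InfinitePlace L // IsComplex w}, BorelSpace ↥(archLocal L 3 (Matrix.diagonal α) w)]
  (ν : ∀ w : {w : InfinitePlace L // IsComplex w}, Measure ↥(archLocal L 3 (Matrix.diagonal α) w))

/-- **The `m`-fold face integrand on `Π_j G_{e j}` is integrable** at regular angles: for `F : (Fin m → M₃(ℂ)) → E` continuous and vanishing as soon as one block leaves the compact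
`C`, `g ↦ F ((↑↑(g_j γ_{e j}(cw_j) g_j⁻¹))_j)` is continuous with support in the compact box of the conjugating sets (§1). [cite: Rogawski1990, §8.2 p. 122] [cite: vanDoorn2021HaarMeasure, §7] -/
theorem integrable_faceIntegrand (hα : ∀ i, α i ≠ 0) [∀ w : {w : InfinitePlace L // IsComplex w}, (ν w).IsHaarMeasure]
    {E : Type} [NormedAddCommGroup E] {m : ℕ} (e : Fin m → {w : InfinitePlace L // IsComplex w}) (he : ∀ j, e j ∉ S')
    (F : (Fin m → Matrix (Fin 3) (Fin 3) ℂ) → E) (hF : Continuous F)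
    {C : Set (Matrix (Fin 3) (Fin 3) ℂ)} (hC : IsCompact C) (hFC : ∀ X : Fin m → Matrix (Fin 3) (Fin 3) ℂ, (∃ j, X j ∉ C) → F X = 0)
    (cw : Fin m → Fin 3 → ℝ) (hreg : ∀ j, Injective fun i : Fin 3 => Circle.exp (cw j i)) :
    Integrable (fun g : ((j : Fin m) → ↥(archLocal L 3 (Matrix.diagonal α) (e j))) =>
        F (fun j => (((g j * gprimeBlockAt L α (e j) S' (cw j) * (g j)⁻¹ : ↥(archLocal L 3 (Matrix.diagonal α) (e j))) : GL (Fin 3) ℂ) : Matrix (Fin 3) (Fin 3) ℂ)))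
      (Measure.pi fun j : Fin m => ν (e j)) := by
  haveI : ∀ w : {w : InfinitePlace L // IsComplex w}, LocallyCompactSpace (archLocal L 3 (Matrix.diagonal α) w) := fun w => locallyCompactSpace_archLocal L 3 (Matrix.diagonal α) w
  haveI : ∀ w : {w : InfinitePlace L // IsComplex w}, SecondCountableTopology (archLocal L 3 (Matrix.diagonal α) w) := fun w => secondCountableTopology_archLocal L 3 (Matrix.diagonal α) w
  have hA : Continuous fun g : ((j : Fin m) → ↥(archLocal L 3 (Matrix.diagonal α) (e j))) => fun j =>
      (((g j * gprimeBlockAt L α (e j) S' (cw j) * (g j)⁻¹ : ↥(archLocal L 3 (Matrix.diagonal α) (e j))) : GL (Fin 3) ℂ) : Matrix (Fin 3) (Fin 3) ℂ) :=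
    continuous_pi fun j => (Units.continuous_val.comp continuous_subtype_val).comp ((((continuous_apply j).mul continuous_const)).mul (continuous_apply j).inv)
  refine (hF.comp hA).integrable_of_hasCompactSupport ?_
  have hS : ∀ j : Fin m, IsCompact {g : ↥(archLocal L 3 (Matrix.diagonal α) (e j)) |
      (((g * gprimeBlockAt L α (e j) S' (cw j) * g⁻¹ : ↥(archLocal L 3 (Matrix.diagonal α) (e j))) : GL (Fin 3) ℂ) : Matrix (Fin 3) (Fin 3) ℂ) ∈ C} :=
    fun j => isCompact_setOf_conj_gprimeBlockAt_mem L α S' hα (he j) (hreg j) hC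
  refine HasCompactSupport.intro (isCompact_univ_pi hS) fun g hg => ?_
  simp only [mem_univ_pi, mem_setOf_eq, not_forall] at hg
  obtain ⟨j, hj⟩ := hg
  exact hFC _ ⟨j, hj⟩

end Prelim

/-! ## §2 The tower: `m` faces at once, by induction on `m` -/

section Tower

variable (L : Type) [Field L] (α : Fin 3 → L) (S' : Finset {w : InfinitePlace L // IsComplex w})
  [∀ w : {w : InfinitePlace L // IsComplex w}, MeasurableSpace ↥(archLocal L 3 (Matrix.diagonal α) w)]
  [∀ w : {w : InfinitePlace L // IsComplex w}, BorelSpace ↥(archLocal L 3 (Matrix.diagonal α) w)]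
  (ν : ∀ w : {w : InfinitePlace L // IsComplex w}, Measure ↥(archLocal L 3 (Matrix.diagonal α) w))
  {J : Matrix (Fin 2) (Fin 2) ℂ} (hJ : J = (StdForm.antidiagonal 2).over ℂ)
  [MeasurableSpace ↥(unitaryGroupOfForm (starRingEnd ℂ) J)] [BorelSpace ↥(unitaryGroupOfForm (starRingEnd ℂ) J)]
  [LocallyCompactSpace ↥(unitaryGroupOfForm (starRingEnd ℂ) J)] [SecondCountableTopology ↥(unitaryGroupOfForm (starRingEnd ℂ) J)]
  (μ₀ : Measure ↥(unitaryGroupOfForm (starRingEnd ℂ) J))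

include hJ in
/-- **THE ITERATED FACE DESCENT (the `m`-fold face tower).**  If at every face `e j ∉ S′` (base angles `pw j`) the ONE-PLACE PARAMETRIC DESCENT `hdesc` holds — for every
finite-dimensional parameter space `P` and every global `C^∞` family `Θ : P × M₃(ℂ) → ℂ` with one compact matrix support there are `K ≠ 0`, an open `U ∋ pw j`, a global `C^∞`
family `f : (P × ℝ³) × M₂(ℂ) → ℂ` with one compact matrix support and the zero-propagation clause, such that at regular `cw ∈ U`
`∫_{G_{e j}} Θ(π, ↑↑(g γ(cw) g⁻¹)) dν = K • ∫_{U(J)} f((π, cw), ↑↑(h · P diag(e^{iψ}, e^{−iψ}) P⁻¹ · h⁻¹)) dμ₀` (`ψ = (cw₀ − cw₂)∕2`) —, then the same holds for the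
`m` faces AT ONCE: for every `P` and every global `C^∞` family `Θ : P × (Fin m → M₃(ℂ)) → ℂ` with blockwise compact support there are `K ≠ 0`, an open `U ∋ pw`, a global `C^∞`
`f : (P × (Fin m → ℝ³)) × (Fin m → M₂(ℂ)) → ℂ` with blockwise compact support and zero propagation, such that at regular `cw ∈ U`
`∫_{Π_j G_{e j}} Θ(π, (↑↑(g_j γ_j(cw_j) g_j⁻¹))_j) d(⊗ν) = K • ∫_{U(J)^m} f((π, cw), (↑↑(h_j · P diag(e^{iψ_j}, e^{−iψ_j}) P⁻¹ · h_j⁻¹))_j) d(⊗μ₀)`.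
Induction on `m`: peel block `0` (Mathlib `measurePreserving_piFinSuccAbove`), descend it with the other blocks as matrix parameters, Fubini (§1 integrability), recurse with the
descended block as a parameter, un-peel on `U(J)^{m+1}` (★ `integrable_towerIntegrand`).
[cite: Varadarajan1977, Part I §3] [cite: Rogawski1990, §4.12 Lemma 4.12.1; §8.2 pp. 119–124] [cite: vanDoorn2021HaarMeasure, §4 Thm. 3; §7] -/
theorem exists_faceDescentTower (hα : ∀ i, α i ≠ 0) [∀ w : {w : InfinitePlace L // IsComplex w}, (ν w).IsHaarMeasure] [μ₀.IsHaarMeasure] :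
    ∀ (m : ℕ) (e : Fin m → {w : InfinitePlace L // IsComplex w}) (pw : Fin m → Fin 3 → ℝ), (∀ j, e j ∉ S') →
      (∀ j : Fin m, ∀ (P : Type) [NormedAddCommGroup P] [NormedSpace ℝ P] [FiniteDimensional ℝ P] (Θ : P × Matrix (Fin 3) (Fin 3) ℂ → ℂ),
        ContDiff ℝ ∞ Θ → ∀ C : Set (Matrix (Fin 3) (Fin 3) ℂ), IsCompact C → (∀ (π : P) (X : Matrix (Fin 3) (Fin 3) ℂ), X ∉ C → Θ (π, X) = 0) →
        ∃ (K : ℝ) (U : Set (Fin 3 → ℝ)) (f : (P × (Fin 3 → ℝ)) × Matrix (Fin 2) (Fin 2) ℂ → ℂ) (C' : Set (Matrix (Fin 2) (Fin 2) ℂ)),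
          K ≠ 0 ∧ IsOpen U ∧ pw j ∈ U ∧ ContDiff ℝ ∞ f ∧ IsCompact C' ∧ (∀ (q : P × (Fin 3 → ℝ)) (X : Matrix (Fin 2) (Fin 2) ℂ), X ∉ C' → f (q, X) = 0) ∧
          (∀ π : P, (∀ X, Θ (π, X) = 0) → ∀ (cw : Fin 3 → ℝ) (X : Matrix (Fin 2) (Fin 2) ℂ), f ((π, cw), X) = 0) ∧
          ∀ (π : P) (cw : Fin 3 → ℝ), cw ∈ U → Injective (fun i : Fin 3 => Circle.exp (cw i)) →
            ∫ g : ↥(archLocal L 3 (Matrix.diagonal α) (e j)),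
                Θ (π, (((g * gprimeBlockAt L α (e j) S' cw * g⁻¹ : ↥(archLocal L 3 (Matrix.diagonal α) (e j))) : GL (Fin 3) ℂ) : Matrix (Fin 3) (Fin 3) ℂ)) ∂(ν (e j)) =
              K • ∫ h : ↥(unitaryGroupOfForm (starRingEnd ℂ) J),
                f ((π, cw), (((h * ⟨Matrix.GeneralLinearGroup.mkOfDetNeZero !![(1 : ℂ), 1; 1, -1] det_cayleyTwo_ne_zero *
                    circleDiagonal 2 ![Circle.exp ((cw 0 - cw 2) / 2), Circle.exp (-((cw 0 - cw 2) / 2))] *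
                    (Matrix.GeneralLinearGroup.mkOfDetNeZero !![(1 : ℂ), 1; 1, -1] det_cayleyTwo_ne_zero)⁻¹, cayley_conj_circleDiagonal_mem_of_eq_over hJ _⟩ * h⁻¹ :
                  ↥(unitaryGroupOfForm (starRingEnd ℂ) J)) : GL (Fin 2) ℂ) : Matrix (Fin 2) (Fin 2) ℂ)) ∂μ₀) →
      ∀ (P : Type) [NormedAddCommGroup P] [NormedSpace ℝ P] [FiniteDimensional ℝ P] (Θ : P × (Fin m → Matrix (Fin 3) (Fin 3) ℂ) → ℂ),
        ContDiff ℝ ∞ Θ → ∀ C : Set (Matrix (Fin 3) (Fin 3) ℂ), IsCompact C →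
        (∀ (π : P) (X : Fin m → Matrix (Fin 3) (Fin 3) ℂ), (∃ j, X j ∉ C) → Θ (π, X) = 0) →
        ∃ (K : ℝ) (U : Set (Fin m → Fin 3 → ℝ)) (f : (P × (Fin m → Fin 3 → ℝ)) × (Fin m → Matrix (Fin 2) (Fin 2) ℂ) → ℂ) (C' : Set (Matrix (Fin 2) (Fin 2) ℂ)),
          K ≠ 0 ∧ IsOpen U ∧ pw ∈ U ∧ ContDiff ℝ ∞ f ∧ IsCompact C' ∧
          (∀ (q : P × (Fin m → Fin 3 → ℝ)) (X : Fin m → Matrix (Fin 2) (Fin 2) ℂ), (∃ j, X j ∉ C') → f (q, X) = 0) ∧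
          (∀ π : P, (∀ X, Θ (π, X) = 0) → ∀ (cw : Fin m → Fin 3 → ℝ) (X : Fin m → Matrix (Fin 2) (Fin 2) ℂ), f ((π, cw), X) = 0) ∧
          ∀ (π : P) (cw : Fin m → Fin 3 → ℝ), cw ∈ U → (∀ j, Injective (fun i : Fin 3 => Circle.exp (cw j i))) →
            ∫ g : ((j : Fin m) → ↥(archLocal L 3 (Matrix.diagonal α) (e j))),
                Θ (π, fun j => (((g j * gprimeBlockAt L α (e j) S' (cw j) * (g j)⁻¹ : ↥(archLocal L 3 (Matrix.diagonal α) (e j))) : GL (Fin 3) ℂ) : Matrix (Fin 3) (Fin 3) ℂ))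
                ∂(Measure.pi fun j : Fin m => ν (e j)) =
              K • ∫ h : Fin m → ↥(unitaryGroupOfForm (starRingEnd ℂ) J),
                f ((π, cw), fun j => (((h j * ⟨Matrix.GeneralLinearGroup.mkOfDetNeZero !![(1 : ℂ), 1; 1, -1] det_cayleyTwo_ne_zero *
                    circleDiagonal 2 ![Circle.exp ((cw j 0 - cw j 2) / 2), Circle.exp (-((cw j 0 - cw j 2) / 2))] *
                    (Matrix.GeneralLinearGroup.mkOfDetNeZero !![(1 : ℂ), 1; 1, -1] det_cayleyTwo_ne_zero)⁻¹, cayley_conj_circleDiagonal_mem_of_eq_over hJ _⟩ * (h j)⁻¹ :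
                  ↥(unitaryGroupOfForm (starRingEnd ℂ) J)) : GL (Fin 2) ℂ) : Matrix (Fin 2) (Fin 2) ℂ)) ∂(Measure.pi fun _ : Fin m => μ₀) := by
  haveI : ∀ w : {w : InfinitePlace L // IsComplex w}, LocallyCompactSpace (archLocal L 3 (Matrix.diagonal α) w) := fun w => locallyCompactSpace_archLocal L 3 (Matrix.diagonal α) w
  haveI : ∀ w : {w : InfinitePlace L // IsComplex w}, SecondCountableTopology (archLocal L 3 (Matrix.diagonal α) w) := fun w => secondCountableTopology_archLocal L 3 (Matrix.diagonal α) w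
  -- abbreviations: the two conjugation readers
  set R3 : (w : {w : InfinitePlace L // IsComplex w}) → ↥(archLocal L 3 (Matrix.diagonal α) w) → (Fin 3 → ℝ) → Matrix (Fin 3) (Fin 3) ℂ := fun w g cw =>
    (((g * gprimeBlockAt L α w S' cw * g⁻¹ : ↥(archLocal L 3 (Matrix.diagonal α) w)) : GL (Fin 3) ℂ) : Matrix (Fin 3) (Fin 3) ℂ) with hR3
  set R2 : ↥(unitaryGroupOfForm (starRingEnd ℂ) J) → ℝ → Matrix (Fin 2) (Fin 2) ℂ := fun h ψ =>
    (((h * ⟨Matrix.GeneralLinearGroup.mkOfDetNeZero !![(1 : ℂ), 1; 1, -1] det_cayleyTwo_ne_zero * circleDiagonal 2 ![Circle.exp ψ, Circle.exp (-ψ)] *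
        (Matrix.GeneralLinearGroup.mkOfDetNeZero !![(1 : ℂ), 1; 1, -1] det_cayleyTwo_ne_zero)⁻¹, cayley_conj_circleDiagonal_mem_of_eq_over hJ _⟩ * h⁻¹ :
      ↥(unitaryGroupOfForm (starRingEnd ℂ) J)) : GL (Fin 2) ℂ) : Matrix (Fin 2) (Fin 2) ℂ) with hR2
  intro m
  induction m with
  | zero =>
    intro e pw he hdesc P _ _ _ Θ hΘ C hC hΘC
    refine ⟨1, univ, fun q => Θ (q.1.1, Fin.elim0), ∅, one_ne_zero, isOpen_univ, mem_univ _, ?_, isCompact_empty, ?_, ?_, ?_⟩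
    · exact hΘ.comp ((contDiff_fst.comp contDiff_fst).prodMk contDiff_const)
    · rintro q X ⟨j, -⟩; exact j.elim0
    · intro π hπ cw X; exact hπ _
    · intro π cw _ _
      rw [integral_pi_of_isEmpty, integral_pi_of_isEmpty, one_smul]
      exact congrArg (fun X => Θ (π, X)) (funext fun j => j.elim0)
  | succ m ih =>
    intro e pw he hdesc P _ _ _ Θ hΘ C hC hΘC
    -- STEP A: descend block `0`, the other blocks being matrix parameters
    obtain ⟨Θ₀, hΘ₀def⟩ : ∃ Θ₀ : (P × (Fin m → Matrix (Fin 3) (Fin 3) ℂ)) × Matrix (Fin 3) (Fin 3) ℂ → ℂ,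
        Θ₀ = fun q => Θ (q.1.1, Fin.cons q.2 q.1.2) := ⟨_, rfl⟩
    have hcons3 : ContDiff ℝ ∞ fun q : (P × (Fin m → Matrix (Fin 3) (Fin 3) ℂ)) × Matrix (Fin 3) (Fin 3) ℂ => (Fin.cons q.2 q.1.2 : Fin (m + 1) → Matrix (Fin 3) (Fin 3) ℂ) := by
      refine contDiff_pi.2 fun k => Fin.cases ?_ (fun j => ?_) k
      · simpa only [Fin.cons_zero] using (contDiff_snd : ContDiff ℝ ∞ fun q : (P × (Fin m → Matrix (Fin 3) (Fin 3) ℂ)) × Matrix (Fin 3) (Fin 3) ℂ => q.2)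
      · simp only [Fin.cons_succ]
        exact (contDiff_apply ℝ (Matrix (Fin 3) (Fin 3) ℂ) j).comp (contDiff_snd.comp contDiff_fst)
    have hΘ₀ : ContDiff ℝ ∞ Θ₀ := by
      rw [hΘ₀def]; exact hΘ.comp ((contDiff_fst.comp contDiff_fst).prodMk hcons3)
    have hΘ₀C : ∀ (q : P × (Fin m → Matrix (Fin 3) (Fin 3) ℂ)) (X : Matrix (Fin 3) (Fin 3) ℂ), X ∉ C → Θ₀ (q, X) = 0 := fun q X hX => by
      rw [hΘ₀def]; exact hΘC _ _ ⟨0, by simpa only [Fin.cons_zero] using hX⟩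
    obtain ⟨K₀, U₀, f₀, C₀, hK₀, hU₀o, hpU₀, hf₀, hC₀, hf₀C, hf₀Z, hf₀I⟩ := hdesc 0 (P × (Fin m → Matrix (Fin 3) (Fin 3) ℂ)) Θ₀ hΘ₀ C hC hΘ₀C
    -- STEP B: recurse on the faces `1..m`, the descended block `0` being a parameter
    obtain ⟨Θ₁, hΘ₁def⟩ : ∃ Θ₁ : ((P × (Fin 3 → ℝ)) × Matrix (Fin 2) (Fin 2) ℂ) × (Fin m → Matrix (Fin 3) (Fin 3) ℂ) → ℂ,
        Θ₁ = fun q => f₀ (((q.1.1.1, q.2), q.1.1.2), q.1.2) := ⟨_, rfl⟩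
    have hΘ₁ : ContDiff ℝ ∞ Θ₁ := by
      rw [hΘ₁def]
      exact hf₀.comp (((((contDiff_fst.comp contDiff_fst).comp contDiff_fst).prodMk contDiff_snd).prodMk
        ((contDiff_snd.comp contDiff_fst).comp contDiff_fst)).prodMk (contDiff_snd.comp contDiff_fst))
    have hΘ₁C : ∀ (q : (P × (Fin 3 → ℝ)) × Matrix (Fin 2) (Fin 2) ℂ) (Y : Fin m → Matrix (Fin 3) (Fin 3) ℂ), (∃ j, Y j ∉ C) → Θ₁ (q, Y) = 0 := by
      rintro q Y ⟨j, hj⟩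
      rw [hΘ₁def]
      refine hf₀Z (q.1.1, Y) (fun X => ?_) _ _
      rw [hΘ₀def]
      exact hΘC _ _ ⟨j.succ, by simpa only [Fin.cons_succ] using hj⟩
    obtain ⟨K₁, U₁, f₁, C₁, hK₁, hU₁o, hpU₁, hf₁, hC₁, hf₁C, hf₁Z, hf₁I⟩ :=
      ih (fun j => e (Fin.succAbove 0 j)) (fun j => pw j.succ) (fun j => he _) (fun j => hdesc _)
        ((P × (Fin 3 → ℝ)) × Matrix (Fin 2) (Fin 2) ℂ) Θ₁ hΘ₁ C hC hΘ₁C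
    -- STEP C: the package for `m + 1`
    refine ⟨K₀ * K₁, {cw | cw 0 ∈ U₀ ∧ (fun j => cw j.succ) ∈ U₁},
      fun q => f₁ ((((q.1.1, q.1.2 0), q.2 0), fun j => q.1.2 j.succ), fun j => q.2 j.succ), C₀ ∪ C₁,
      mul_ne_zero hK₀ hK₁, ?_, ⟨hpU₀, hpU₁⟩, ?_, hC₀.union hC₁, ?_, ?_, ?_⟩
    · exact (hU₀o.preimage (continuous_apply 0)).inter (hU₁o.preimage (continuous_pi fun j => continuous_apply (Fin.succ j)))
    · refine hf₁.comp ((((?_ : ContDiff ℝ ∞ _).prodMk ?_).prodMk ?_).prodMk ?_)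
      · exact (contDiff_fst.comp contDiff_fst).prodMk
          ((contDiff_apply ℝ (Fin 3 → ℝ) 0).comp (contDiff_snd.comp contDiff_fst))
      · exact (contDiff_apply ℝ (Matrix (Fin 2) (Fin 2) ℂ) 0).comp contDiff_snd
      · exact contDiff_pi.2 fun j => (contDiff_apply ℝ (Fin 3 → ℝ) (Fin.succ j)).comp (contDiff_snd.comp contDiff_fst)
      · exact contDiff_pi.2 fun j => (contDiff_apply ℝ (Matrix (Fin 2) (Fin 2) ℂ) (Fin.succ j)).comp contDiff_snd
    · rintro q X ⟨j, hj⟩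
      rw [mem_union, not_or] at hj
      refine Fin.cases ?_ (fun j' => ?_) j hj
      · intro hj0
        refine hf₁Z ((q.1, q.2 0), X 0) (fun Y => ?_) _ _
        rw [hΘ₁def]
        exact hf₀C _ _ hj0.1
      · intro hjs
        exact hf₁C _ _ ⟨j', hjs.2⟩
    · intro π hπ cw X
      refine hf₁Z ((π, cw 0), X 0) (fun Y => ?_) _ _
      rw [hΘ₁def]
      refine hf₀Z (π, Y) (fun X' => ?_) _ _
      rw [hΘ₀def]
      exact hπ _
    · -- STEP D: the identity
      rintro π cw ⟨hcw0, hcwt⟩ hreg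
      have hψne : ∀ j : Fin (m + 1), Real.sin ((cw j 0 - cw j 2) / 2) ≠ 0 := fun j => sin_half_sub_ne_zero_of_injective_circleExp (hreg j)
      -- (D1) peel block `0` on the group side and integrate it first
      have hΘπ : Continuous fun X : Fin (m + 1) → Matrix (Fin 3) (Fin 3) ℂ => Θ (π, X) := hΘ.continuous.comp (continuous_const.prodMk continuous_id)
      have hInt : Integrable (fun g : ((j : Fin (m + 1)) → ↥(archLocal L 3 (Matrix.diagonal α) (e j))) => Θ (π, fun j => R3 (e j) (g j) (cw j)))
          (Measure.pi fun j : Fin (m + 1) => ν (e j)) :=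
        integrable_faceIntegrand L α S' ν hα e he (fun X => Θ (π, X)) hΘπ hC (fun X hX => hΘC π X hX) cw hreg
      have hmp := (measurePreserving_piFinSuccAbove (fun j : Fin (m + 1) => ν (e j)) 0).symm _
      have hsymm : ∀ p : ↥(archLocal L 3 (Matrix.diagonal α) (e 0)) × ((j : Fin m) → ↥(archLocal L 3 (Matrix.diagonal α) (e (Fin.succAbove 0 j)))),
          (MeasurableEquiv.piFinSuccAbove (fun j : Fin (m + 1) => ↥(archLocal L 3 (Matrix.diagonal α) (e j))) 0).symm p =
            (Fin.cons p.1 p.2 : (j : Fin (m + 1)) → ↥(archLocal L 3 (Matrix.diagonal α) (e j))) := fun p => by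
        show Fin.insertNth 0 p.1 p.2 = (Fin.cons p.1 p.2 : (j : Fin (m + 1)) → ↥(archLocal L 3 (Matrix.diagonal α) (e j)))
        exact Fin.insertNth_zero (α := fun j : Fin (m + 1) => ↥(archLocal L 3 (Matrix.diagonal α) (e j))) p.1 p.2
      have hcv := hmp.integral_comp' (fun g : ((j : Fin (m + 1)) → ↥(archLocal L 3 (Matrix.diagonal α) (e j))) => Θ (π, fun j => R3 (e j) (g j) (cw j)))
      have hInt' : Integrable (fun p : ↥(archLocal L 3 (Matrix.diagonal α) (e 0)) × ((j : Fin m) → ↥(archLocal L 3 (Matrix.diagonal α) (e (Fin.succAbove 0 j)))) =>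
          Θ (π, fun j => R3 (e j) ((Fin.cons p.1 p.2 : (j : Fin (m + 1)) → ↥(archLocal L 3 (Matrix.diagonal α) (e j))) j) (cw j)))
          ((ν (e 0)).prod (Measure.pi fun j : Fin m => ν (e (Fin.succAbove 0 j)))) := by
        have h := (hmp.integrable_comp_emb (MeasurableEquiv.measurableEmbedding _)).2 hInt
        refine h.congr (Filter.Eventually.of_forall fun p => ?_)
        simp only [Function.comp_apply, hsymm]
      -- the remaining blocks read as matrices
      set Y' : ((j : Fin m) → ↥(archLocal L 3 (Matrix.diagonal α) (e (Fin.succAbove 0 j)))) → (Fin m → Matrix (Fin 3) (Fin 3) ℂ) :=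
        fun g' j => R3 (e (Fin.succAbove 0 j)) (g' j) (cw j.succ) with hY'
      have hcons : ∀ (g₀ : ↥(archLocal L 3 (Matrix.diagonal α) (e 0))) (g' : (j : Fin m) → ↥(archLocal L 3 (Matrix.diagonal α) (e (Fin.succAbove 0 j)))),
          (fun j => R3 (e j) ((Fin.cons g₀ g' : (j : Fin (m + 1)) → ↥(archLocal L 3 (Matrix.diagonal α) (e j))) j) (cw j)) =
            Fin.cons (R3 (e 0) g₀ (cw 0)) (Y' g') := by
        intro g₀ g'
        funext j
        refine Fin.cases ?_ (fun j' => ?_) j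
        · simp only [Fin.cons_zero]
        · simp only [Fin.cons_succ]; rfl
      -- (D2) the mixed integrand `(g', h₀) ↦ f₀ (((π, Y' g'), cw 0), R2 h₀ ψ₀)` is integrable
      have hY'c : Continuous Y' :=
        continuous_pi fun j => (Units.continuous_val.comp continuous_subtype_val).comp ((((continuous_apply j).mul continuous_const)).mul (continuous_apply j).inv)
      have hR2c : Continuous fun h : ↥(unitaryGroupOfForm (starRingEnd ℂ) J) => R2 h ((cw 0 0 - cw 0 2) / 2) :=
        (Units.continuous_val.comp continuous_subtype_val).comp ((continuous_id.mul continuous_const).mul continuous_id.inv)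
      have hInt_mix : Integrable (uncurry fun (g' : (j : Fin m) → ↥(archLocal L 3 (Matrix.diagonal α) (e (Fin.succAbove 0 j)))) (h₀ : ↥(unitaryGroupOfForm (starRingEnd ℂ) J)) =>
          f₀ (((π, Y' g'), cw 0), R2 h₀ ((cw 0 0 - cw 0 2) / 2)))
          ((Measure.pi fun j : Fin m => ν (e (Fin.succAbove 0 j))).prod μ₀) := by
        have hc : Continuous (uncurry fun (g' : (j : Fin m) → ↥(archLocal L 3 (Matrix.diagonal α) (e (Fin.succAbove 0 j)))) (h₀ : ↥(unitaryGroupOfForm (starRingEnd ℂ) J)) =>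
            f₀ (((π, Y' g'), cw 0), R2 h₀ ((cw 0 0 - cw 0 2) / 2))) :=
          hf₀.continuous.comp ((((continuous_const.prodMk (hY'c.comp continuous_fst)).prodMk continuous_const)).prodMk (hR2c.comp continuous_snd))
        refine hc.integrable_of_hasCompactSupport ?_
        have hS : ∀ j : Fin m, IsCompact {g : ↥(archLocal L 3 (Matrix.diagonal α) (e (Fin.succAbove 0 j))) |
            R3 (e (Fin.succAbove 0 j)) g (cw j.succ) ∈ C} :=
          fun j => isCompact_setOf_conj_gprimeBlockAt_mem L α S' hα (he _) (hreg _) hC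
        have hS₀ : IsCompact {h : ↥(unitaryGroupOfForm (starRingEnd ℂ) J) | R2 h ((cw 0 0 - cw 0 2) / 2) ∈ C₀} :=
          isCompact_setOf_conj_cayleyTorus_one_mem hJ (hψne 0) hC₀
        refine HasCompactSupport.intro ((isCompact_univ_pi hS).prod hS₀) fun p hp => ?_
        rw [mem_prod, mem_univ_pi, not_and_or] at hp
        rcases hp with hp | hp
        · obtain ⟨j, hj⟩ := not_forall.1 hp
          have hj' : Y' p.1 j ∉ C := hj
          show f₀ (((π, Y' p.1), cw 0), R2 p.2 ((cw 0 0 - cw 0 2) / 2)) = 0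
          refine hf₀Z (π, Y' p.1) (fun X => ?_) _ _
          rw [hΘ₀def]
          exact hΘC _ _ ⟨j.succ, by simpa only [Fin.cons_succ] using hj'⟩
        · exact hf₀C _ _ hp
      -- (D3) the `U(J)^{m+1}` side: integrability, peel
      have hfc : Continuous fun X : Fin (m + 1) → Matrix (Fin 2) (Fin 2) ℂ =>
          f₁ ((((π, cw 0), X 0), fun j => cw j.succ), fun j => X j.succ) :=
        hf₁.continuous.comp ((((continuous_const.prodMk (continuous_apply 0)).prodMk continuous_const)).prodMk
          (continuous_pi fun j => continuous_apply (Fin.succ j)))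
      have hfCX : ∀ X : Fin (m + 1) → Matrix (Fin 2) (Fin 2) ℂ, (∃ k, X k ∉ C₀ ∪ C₁) →
          f₁ ((((π, cw 0), X 0), fun j => cw j.succ), fun j => X j.succ) = 0 := by
        rintro X ⟨k, hk⟩
        rw [mem_union, not_or] at hk
        refine Fin.cases ?_ (fun j' => ?_) k hk
        · intro hk0
          refine hf₁Z ((π, cw 0), X 0) (fun Y => ?_) _ _
          rw [hΘ₁def]
          exact hf₀C _ _ hk0.1
        · intro hks
          exact hf₁C _ _ ⟨j', hks.2⟩
      have hIntU := integrable_towerIntegrand hJ μ₀ (fun X : Fin (m + 1) → Matrix (Fin 2) (Fin 2) ℂ =>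
          f₁ ((((π, cw 0), X 0), fun j => cw j.succ), fun j => X j.succ)) hfc (hC₀.union hC₁) hfCX
        (fun j => (cw j 0 - cw j 2) / 2) hψne
      have hmpU := (measurePreserving_piFinSuccAbove (fun _ : Fin (m + 1) => μ₀) 0).symm _
      have hsymmU : ∀ p : ↥(unitaryGroupOfForm (starRingEnd ℂ) J) × (Fin m → ↥(unitaryGroupOfForm (starRingEnd ℂ) J)),
          (MeasurableEquiv.piFinSuccAbove (fun _ : Fin (m + 1) => ↥(unitaryGroupOfForm (starRingEnd ℂ) J)) 0).symm p =
            (Fin.cons p.1 p.2 : Fin (m + 1) → ↥(unitaryGroupOfForm (starRingEnd ℂ) J)) := fun p => by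
        show Fin.insertNth 0 p.1 p.2 = (Fin.cons p.1 p.2 : Fin (m + 1) → ↥(unitaryGroupOfForm (starRingEnd ℂ) J))
        exact Fin.insertNth_zero' p.1 p.2
      have hcvU := hmpU.integral_comp' (fun h : Fin (m + 1) → ↥(unitaryGroupOfForm (starRingEnd ℂ) J) =>
          f₁ ((((π, cw 0), R2 (h 0) ((cw 0 0 - cw 0 2) / 2)), fun j => cw j.succ), fun j => R2 (h j.succ) ((cw j.succ 0 - cw j.succ 2) / 2)))
      have hIntU' : Integrable (fun p : ↥(unitaryGroupOfForm (starRingEnd ℂ) J) × (Fin m → ↥(unitaryGroupOfForm (starRingEnd ℂ) J)) =>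
          f₁ ((((π, cw 0), R2 p.1 ((cw 0 0 - cw 0 2) / 2)), fun j => cw j.succ), fun j => R2 (p.2 j) ((cw j.succ 0 - cw j.succ 2) / 2)))
          (μ₀.prod (Measure.pi fun _ : Fin m => μ₀)) := by
        have h := (hmpU.integrable_comp_emb (MeasurableEquiv.measurableEmbedding _)).2 hIntU
        refine h.congr (Filter.Eventually.of_forall fun p => ?_)
        simp only [Function.comp_apply, hsymmU, Fin.cons_zero, Fin.cons_succ]
        rfl
      -- (D4) assemble
      have hLHS : ∫ g : ((j : Fin (m + 1)) → ↥(archLocal L 3 (Matrix.diagonal α) (e j))), Θ (π, fun j => R3 (e j) (g j) (cw j)) ∂(Measure.pi fun j : Fin (m + 1) => ν (e j)) =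
          K₀ • ∫ h₀ : ↥(unitaryGroupOfForm (starRingEnd ℂ) J), ∫ g' : ((j : Fin m) → ↥(archLocal L 3 (Matrix.diagonal α) (e (Fin.succAbove 0 j)))),
            f₀ (((π, Y' g'), cw 0), R2 h₀ ((cw 0 0 - cw 0 2) / 2)) ∂(Measure.pi fun j : Fin m => ν (e (Fin.succAbove 0 j))) ∂μ₀ := by
        rw [← hcv]
        simp_rw [hsymm]
        rw [integral_prod_symm _ hInt']
        simp_rw [hcons]
        have hstep : ∀ g' : ((j : Fin m) → ↥(archLocal L 3 (Matrix.diagonal α) (e (Fin.succAbove 0 j)))),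
            ∫ g₀ : ↥(archLocal L 3 (Matrix.diagonal α) (e 0)), Θ (π, Fin.cons (R3 (e 0) g₀ (cw 0)) (Y' g')) ∂(ν (e 0)) =
              K₀ • ∫ h₀ : ↥(unitaryGroupOfForm (starRingEnd ℂ) J), f₀ (((π, Y' g'), cw 0), R2 h₀ ((cw 0 0 - cw 0 2) / 2)) ∂μ₀ := by
          intro g'
          have h := hf₀I (π, Y' g') (cw 0) hcw0 (hreg 0)
          rw [hΘ₀def] at h
          exact h
        simp_rw [hstep]
        rw [integral_smul, integral_integral_swap hInt_mix]
      have hMID : ∀ h₀ : ↥(unitaryGroupOfForm (starRingEnd ℂ) J),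
          ∫ g' : ((j : Fin m) → ↥(archLocal L 3 (Matrix.diagonal α) (e (Fin.succAbove 0 j)))), f₀ (((π, Y' g'), cw 0), R2 h₀ ((cw 0 0 - cw 0 2) / 2)) ∂(Measure.pi fun j : Fin m => ν (e (Fin.succAbove 0 j))) =
            K₁ • ∫ h' : Fin m → ↥(unitaryGroupOfForm (starRingEnd ℂ) J),
              f₁ ((((π, cw 0), R2 h₀ ((cw 0 0 - cw 0 2) / 2)), fun j => cw j.succ), fun j => R2 (h' j) ((cw j.succ 0 - cw j.succ 2) / 2))
              ∂(Measure.pi fun _ : Fin m => μ₀) := by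
        intro h₀
        have h := hf₁I ((π, cw 0), R2 h₀ ((cw 0 0 - cw 0 2) / 2)) (fun j => cw j.succ) hcwt (fun j => hreg _)
        rw [hΘ₁def] at h
        exact h
      have hRHS : ∫ h : Fin (m + 1) → ↥(unitaryGroupOfForm (starRingEnd ℂ) J),
          f₁ ((((π, cw 0), R2 (h 0) ((cw 0 0 - cw 0 2) / 2)), fun j => cw j.succ), fun j => R2 (h j.succ) ((cw j.succ 0 - cw j.succ 2) / 2)) ∂(Measure.pi fun _ : Fin (m + 1) => μ₀) =
          ∫ h₀ : ↥(unitaryGroupOfForm (starRingEnd ℂ) J), ∫ h' : Fin m → ↥(unitaryGroupOfForm (starRingEnd ℂ) J),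
            f₁ ((((π, cw 0), R2 h₀ ((cw 0 0 - cw 0 2) / 2)), fun j => cw j.succ), fun j => R2 (h' j) ((cw j.succ 0 - cw j.succ 2) / 2))
              ∂(Measure.pi fun _ : Fin m => μ₀) ∂μ₀ := by
        rw [← hcvU]
        simp_rw [hsymmU]
        simp only [Fin.cons_zero, Fin.cons_succ]
        exact integral_prod _ hIntU'
      have key : ∫ g : ((j : Fin (m + 1)) → ↥(archLocal L 3 (Matrix.diagonal α) (e j))), Θ (π, fun j => R3 (e j) (g j) (cw j)) ∂(Measure.pi fun j : Fin (m + 1) => ν (e j)) =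
          (K₀ * K₁) • ∫ h : Fin (m + 1) → ↥(unitaryGroupOfForm (starRingEnd ℂ) J),
            f₁ ((((π, cw 0), R2 (h 0) ((cw 0 0 - cw 0 2) / 2)), fun j => cw j.succ), fun j => R2 (h j.succ) ((cw j.succ 0 - cw j.succ 2) / 2)) ∂(Measure.pi fun _ : Fin (m + 1) => μ₀) := by
        rw [hLHS, hRHS]
        simp_rw [hMID]
        rw [integral_smul, smul_smul]
      simpa only [hR3, hR2] using key

end Tower

end Literature.NumberTheory.Rogawski1990

end
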